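import Summits.QuantumFields.BalabanUV.T4Continuum.Spine.NE3.LandauProjectionSupShape
import Summits.QuantumFields.BalabanUV.T4Continuum.Spine.NE3.CovLiftDivergenceB8
import Summits.QuantumFields.BalabanUV.T4Continuum.Spine.NE3.QbarRightInverseB8
import Summits.QuantumFields.BalabanUV.T4Continuum.Support.NE3SmoothRightInverseFlat
import Summits.QuantumFields.BalabanUV.T4Continuum.Support.NE3LandauOrbit
import Summits.QuantumFields.BalabanUV.T4Continuum.Support.NE3FlatHessianCurl
import Summits.QuantumFields.BalabanUV.T4Continuum.Support.NE3CurvedCornerGaugeSpace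
import Summits.QuantumFields.BalabanUV.T4Continuum.Support.NE3HilbertSchmidtTorus
import HarnessLib

/-!
# T⁴ programme, node NE3 — census R34: THE [B9] (3.42)∕(3.48) SUP LETTER `LandauCorrectionSupB8` AT THE FLAT DATUM, REDUCED TO TWO FLAT
# SUP-NORM FACTS — for EVERY torus size `N`, every `L ≥ 2`, every level `j`: `hK` at `W = 1` with `K₀ = 6d·liftC·c₀·c_R`, `K₁ = 6d·liftC·c₁·c_R`
# ⇐ (H0) sup-regularity of `Δ` on `N(Q′(1))` (`‖u‖_∞ ≤ c₀M²‖Δu‖_∞`, `‖∇u‖_∞ ≤ c₁M‖Δu‖_∞`) ∧ (HR) `ℓ^∞`-boundedness `c_R` of the (1.38)-projection `R(1)`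

Cell `pub-balaban-gaps` (YM blitz, track G2, seat `ne3`, unit `pub-balaban-gaps-ne3`; writer prover-pub-balaban-gaps-ne3-g7-0, 2026-08-24), census
`run/shared/lean/pub/pub-balaban-gaps/ne/NE3.md` §4 R34, §13 (finding F12).  THE PROBLEM.  The END of NE3's local half on B8's surface
(`Spine/NE3/PairLandauB8EndSfClassTowers.ne3EnergyRateWCov_sfClass_towers`, `EndLinesNonVacuous.ne3EnergyRateWCov_sfClass_small`) consumes, per pair, the
hypothesis SHAPE `LandauProjectionSupShape.LandauCorrectionSupB8` (the sup letter of the (1.38)-Landau correction `λ` of route Π's lift of the solved datum;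
printed TYPE [Balaban1985BackgroundPropagators] (3.42)∕(3.48)).  Gens 5–6 showed that the END's OTHER [B9] shape, `(P♮)` on `slicB8`, HOLDS at the flat background for
every `N` (`SlicePoincareSlicB8FlatAllN`).  THIS FILE does the corresponding bookkeeping for `hK` at the flat background `W = flatCfg`: it is NOT an energy statement
but a SUP statement, so it cannot be kinematic; what it reduces to is located exactly.

THE REDUCTION (all `N ≥ 1`, `L ≥ 2`, `j ≥ 0`; `M = L^{j+1}`).  At `W = 1` the straight defect of route Π's right inverse VANISHES (`straightDefect_flatCfg`:
`QbarIter L (j+1) 1 ∘ covLift M 1 = id` on coarse data, from `QbarIter_flat`, `covLift_flat` and `NE3SmoothLiftFlat.linQ_smoothLift`), so the solved datum IS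
the datum (`solveW_flatCfg`) and the lift of the solved datum IS the smooth lift of `φ` (`covLift_solveW_flatCfg`); its flat divergence `F := covDiv 1 Y` is a
BOUNDED SMOOTH SOURCE, `‖F‖_∞ ≤ 6d·liftC·s∕M²` (`norm_covDiv_covLift_flatCfg_le`, from the divergence letter `CovLiftDivergenceB8.norm_covDiv_covLift_le` at
plaquette radius `0`) — one order of `M` better than `Y` itself, because the lift vanishes on every block face and its profile is Lipschitz at scale `M`.
The (1.38)-Landau condition on `Y + D_1λ`, tested against `Δ_1 N(Q′(1))` and summed by parts (`NE3LandauOrbit.sum_hsR_gaugeDir`, `covDiv ∘ gaugeDir = covLapSite`),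
says `F + Δ_1λ ⊥ Δ_1N(Q′(1))` over the period box, i.e. `Δ_1λ = −R(1)F` with `R(1)` the `hsR`-orthogonal projection ONTO `Δ_1N(Q′(1))` ([Balaban1985RegularSpaces]
p. 80; [Balaban1985BackgroundPropagators] (3.25) `R = I − G′Q′*(Q′G′²Q′*)⁻¹Q′G′`).  Hence:
* (HR) — the `ℓ^∞ → ℓ^∞` bound of `R(1)`, in solution form: `F + Δμ ⊥ ΔN(Q′)`, `μ ∈ N(Q′)` ⟹ `‖Δμ‖_∞ ≤ c_R‖F‖_∞` — gives `‖Δ_1λ‖_∞ ≤ c_R·6d·liftC·s∕M²`;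
* (H0) — sup-regularity of the site Laplacian on `N(Q′(1))` (where `Δ_1 = (Δ_1 + M⁻²Q′*Q′)`, i.e. `G′(1)` read on `Δ_1N(Q′(1))`): `‖u‖_∞ ≤ c₀M²‖Δ_1u‖_∞`,
  `‖D_1u‖_∞ ≤ c₁M‖Δ_1u‖_∞` for `u ∈ N(Q′(1))` — gives `‖λ‖_∞ ≤ 6d·liftC·c₀c_R·s` and `‖D_1λ‖_∞ ≤ 6d·liftC·c₁c_R·s∕M`: the shape, with `K₀ = 6d·liftC·c₀·c_R`,
  `K₁ = 6d·liftC·c₁·c_R`, INDEPENDENT of `j`, `N`, `x` (**`landauCorrectionSupB8_flatCfg_of_supFacts`**).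
No second-order (`∇G′∇*`, Hölder currency (3.43)∕(3.45)) and no `G′∇*` entry is needed at the flat datum: the smoothness of route Π's lift absorbs one derivative.

WHAT (H0)∕(HR) ARE (finding F12, located; NOT proved here).  Both are `U = 1` statements of [Balaban1984PropagatorsII] Prop. 2.2 (2.67) (entries `|G′λ|`,
`|∇G′λ|`, uniform in the mesh `η = M⁻¹` and the volume) and of [Balaban1985BackgroundPropagators] (3.49) for `P = I − R` (row sums of a kernel bounded by
`O(1)(L^kη)^{−d}e^{−δ₀d(y,y′)}`), which the Literature holds KERNEL-CHECKED on ITS carriers: `B6Prop22OneScaleTorus.prop22Printed_oneScaleTorus` (one-scale torus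
family: `L` odd, `N = 2L^m`), `B8Ineq198MultiLevelTorusP22` ∕ `B9Ineq349MultiLevelTorusP23.ineq349_multiLevelTorus_P23` (multi-level torus: `N_μ = L·M_h·P_μ`,
`M_h ≥ 3`, `P_μ ≥ 4`, thresholds `L·M_h ≥ M₀`), `B6Prop23OneScaleTorus.ineq287_oneScaleTorus` ((2.87), every period vector).  NONE of these carrier families is the
tree's `Site d = Fin d → ℤ` with period `N·L^{j+1}` for ALL `(L, N)`; the transposition (scalar ⟶ `𝔲(n)`-valued componentwise, torus isomorphism, `Q′`∕`Δ`
dictionaries, kernel row sums ⟶ the solution forms below) is the named debt (census R34: M–L, bookkeeping only).  So this file CLOSES NOTHING: it converts the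
flat-datum `hK` into two displayed scalar facts and records what they are.

CONTENT (0 sorry; no `def`; [folklore] kinematics of OUR objects): §1 flat exactness of route Π's lift and solve (`QbarIter_flatCfg_covLift`, `straightDefect_flatCfg`,
`solveW_flatCfg`, `covLift_solveW_flatCfg`); §2 the flat divergence source (`norm_covDiv_covLift_flatCfg_le`; additivity `NE3HilbertSchmidtTorus.covDiv_add_fun` by name); §3 the Euler–Lagrange form of (1.38)
at the flat datum (`sum_hsR_covDiv_add_covLapSite_eq_zero_of_isLandauB8_flatCfg`); §4 **`landauCorrectionSupB8_flatCfg_of_supFacts`**.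

HONEST FRAMING.  A CONDITIONAL reduction at the TRIVIAL background: `hK` at `W = 1` ⇐ two named flat sup-norm facts (H0), (HR), taken as displayed hypotheses
(no `def … : Prop`, no printed sentence as hypothesis); (H0)∕(HR) are NOT proved here for any `(L, N)`; nothing about curved backgrounds `W = cavg L U_B`, nothing
about Bałaban's minimisers; `hK` over `sfClass`, (P♮) at curved `W`, `PairLandauGaugeB8Avg`, the covariant root and **NE3 are NOT proved**; spine PROVED 0∕9; finite T⁴
rung (B)+1 — NOT infinite volume, NOT mass gap, NOT `BetaPertH`, NOT Clay.  PLACEMENT: `Summits/QuantumFields/BalabanUV/T4Continuum/Spine/NE3/`; imports accepted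
modules only; moves nothing.  HONEST DEPENDENCY (cell page 1): continuum YM on T⁴ ⇐ BetaPertH ∧ nine spine estimates (0/9 proved); BetaPertH ⇐ (D1) ∧ (D4) ∧
CAP+tail; G-an2-4 gates asym, D1 and NE2/3/4.
-/

set_option autoImplicit false

open scoped BigOperators Matrix Matrix.Norms.L2Operator
open NormedSpace Finset

namespace Summit.QuantumFields.BalabanUV.T4Continuum.NE3.LandauCorrectionSupB8Flat

open Literature.MathematicalPhysics.QuantumFieldTheory.Balaban1983to89
open B7Prop1Explicit B7Prop2Explicit
open T4AveragingDeficitWall (Ad IsUnitaryCfg IsSkewDir SmallField)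
open T4AveragingDeficitWallBoundary (IsPeriodicCfg periodBox)
open AveragingDeficitPeriodicCounting (IsPeriodicDir)
open AveragingDeficitTwoLevelPrep (skewSub)
open AveragingDeficitMultiLevelPrep (LevelSmall tower)
open AveragingDeficitTorusChart (TDir extDir resDir redN_boxVec extDir_resDir)
open BlockAveragePushDirGauge (gaugeDir isPeriodicDir_gaugeDir)
open BlockAveragePushDirSplit (flat)
open MinimalActionWitness (flatCfg isPeriodicCfg_flatCfg)
open SmoothRefineBlocks (blk)
open NE3TangentCovariantTower (QbarIter QbarIter_flat)
open NE3TangentFlatPush (flatCfg_eq_flat)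
open NE3CovariantLift (covLift covLift_flat)
open NE3SmoothLiftFlat (smoothLift linQ_smoothLift)
open NE3SmoothRightInverseFlat (iterate_Qcoarse_apply)
open NE3QbarIterCovLiftPrep (cruxC liftC liftC_nonneg)
open NE3SmoothRightInverseW (solveW resSkew coe_resSkew straightDefect straightDefectSkew straightDefect_apply solveW_eq)
open NE3CovariantCalculus (hsR)
open NE3CovariantWeitzenbock (covDiv)
open NE3HilbertSchmidtTorus (covDiv_add_fun)
open NE3LandauOrbit (sum_hsR_gaugeDir covDiv_add_period)
open NE3CurvedCornerGaugeSpace (covDiv_mem_skewAdjoint)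
open NE3FlatHessianCurl (isUnitaryCfg_flatCfg smallField_flatCfg_zero)
open NE3.PairLandauB8 (avgKernelGauges mem_avgKernelGauges_iff covLapSite IsLandauB8)
open NE3.LandauProjectionB8 (covDiv_gaugeDir_eq_covLapSite covLapSite_add_period)
open NE3.LandauProjectionSupShape (LandauCorrectionSupB8)
open NE3.CovLiftDivergenceB8 (norm_covDiv_covLift_le)
open NE3.QbarRightInverseB8 (covLift_solveW_skew covLift_solveW_periodic)

noncomputable section

variable {d : ℕ} {n : Type*} [Fintype n] [DecidableEq n]

/-! ## §1 At the flat background route Π's straight defect vanishes: the solved datum is the datum, the lift is the smooth lift -/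

/-- **`QbarIter L (k+1) 1 ∘ covLift (L^{k+1}) 1 = id` ON COARSE DATA**: at the flat background the `(k+1)`-fold linearised double-bar average is the straight-line
`M`-block average (`QbarIter_flat`, `iterate_Qcoarse_apply`), the covariant lift is the smooth lift (`covLift_flat`), and the smooth lift is EXACT under the
straight-line average (`NE3SmoothLiftFlat.linQ_smoothLift`). [folklore] -/
theorem QbarIter_flatCfg_covLift {L : ℕ} (hL : 2 ≤ L) (k : ℕ) (Φ : Site d → Fin d → Matrix n n ℂ) (z : Site d) (κ : Fin d) :
    QbarIter L (k + 1) (flatCfg (d := d) (n := n)) (covLift (L ^ (k + 1)) (flatCfg (d := d) (n := n)) Φ) z κ = Φ z κ := by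
  have hL1 : 1 ≤ L := by omega
  have hM2 : 2 ≤ L ^ (k + 1) := le_trans hL (Nat.le_self_pow (by omega) L)
  rw [flatCfg_eq_flat, QbarIter_flat hL1, covLift_flat, iterate_Qcoarse_apply]
  exact linQ_smoothLift hM2 Φ z κ

section FlatSolve

variable [Nonempty n] {L : ℕ} (hL : 2 ≤ L) (k : ℕ) {x : ℝ} (hWu : IsUnitaryCfg (flatCfg (d := d) (n := n))) (hx : 0 ≤ x)
  (hs : LevelSmall d L k x) (hWx : SmallField (flatCfg (d := d) (n := n)) x) (N : ℕ) [NeZero N]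

/-- **THE STRAIGHT DEFECT VANISHES AT THE FLAT BACKGROUND**: `K ψ = res (QbarIter 1 (covLift 1 (ext ψ)) − ext ψ) = 0`. [folklore] -/
theorem straightDefect_flatCfg (ψ : TDir d n N) : straightDefect hL k hWu hx hs hWx N ψ = 0 := by
  funext r κ
  rw [straightDefect_apply, QbarIter_flatCfg_covLift hL k]
  simp only [extDir, redN_boxVec, sub_self]
  rfl

/-- **THE SOLVED DATUM IS THE DATUM AT THE FLAT BACKGROUND**: `(1 + K)⁻¹ρ = ρ` since `K = 0` (`solveW_eq`). [folklore] -/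
theorem solveW_flatCfg (hθ : cruxC d L * (((L : ℝ) ^ (k + 1)) ^ 2 * x) < 1) (ρ : ↥(skewSub d n N)) :
    solveW hL k hWu hx hs hWx N hθ ρ = ρ := by
  have h := solveW_eq hL k hWu hx hs hWx N hθ ρ
  have hK : straightDefectSkew hL k hWu hx hs hWx N (solveW hL k hWu hx hs hWx N hθ ρ) = 0 := by
    apply Subtype.ext
    show straightDefect hL k hWu hx hs hWx N ((solveW hL k hWu hx hs hWx N hθ ρ : ↥(skewSub d n N)) : TDir d n N) = 0
    exact straightDefect_flatCfg hL k hWu hx hs hWx N _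
  rwa [hK, add_zero] at h

/-- **THE LIFT OF THE SOLVED DATUM AT THE FLAT BACKGROUND IS THE LIFT OF THE DATUM** (`φ` skew and `N`-periodic). [folklore] -/
theorem covLift_solveW_flatCfg (hθ : cruxC d L * (((L : ℝ) ^ (k + 1)) ^ 2 * x) < 1) {φ : Site d → Fin d → Matrix n n ℂ}
    (hφ : IsSkewDir φ) (hφP : IsPeriodicDir φ (N : ℤ)) :
    covLift (L ^ (k + 1)) (flatCfg (d := d) (n := n))
        (extDir N ((solveW hL k hWu hx hs hWx N hθ (resSkew N hφ) : ↥(skewSub d n N)) : TDir d n N))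
      = covLift (L ^ (k + 1)) (flatCfg (d := d) (n := n)) φ := by
  rw [solveW_flatCfg hL k hWu hx hs hWx N hθ, coe_resSkew, extDir_resDir N hφP]

end FlatSolve

/-! ## §2 The flat divergence of the lift: a bounded smooth source of size `6d·liftC·s∕M²` -/

/-- **THE SUP OF THE FLAT DIVERGENCE OF THE LIFT**: for `‖Φ‖_∞ ≤ s`, `‖covDiv 1 (covLift M 1 Φ) x‖ ≤ 6·d·liftC∕M²·s` at every site (`M ≥ 2`) — the divergence
letter `CovLiftDivergenceB8.norm_covDiv_covLift_le` at plaquette radius `0`. [folklore] -/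
theorem norm_covDiv_covLift_flatCfg_le [Nonempty n] {M : ℕ} (hM : 2 ≤ M) (Φ : Site d → Fin d → Matrix n n ℂ) {s : ℝ}
    (hΦs : ∀ (z : Site d) (κ : Fin d), ‖Φ z κ‖ ≤ s) (x : Site d) :
    ‖covDiv (flatCfg (d := d) (n := n)) (covLift M (flatCfg (d := d) (n := n)) Φ) x‖ ≤ 6 * (d : ℝ) * liftC d / (M : ℝ) ^ 2 * s := by
  have h := norm_covDiv_covLift_le hM isUnitaryCfg_flatCfg le_rfl smallField_flatCfg_zero Φ x
  have hsum : ∑ μ : Fin d, ‖Φ (blk M (x - e μ)) μ‖ ≤ (d : ℝ) * s := by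
    calc ∑ μ : Fin d, ‖Φ (blk M (x - e μ)) μ‖ ≤ ∑ _μ : Fin d, s := Finset.sum_le_sum fun μ _ => hΦs _ μ
      _ = (d : ℝ) * s := by simp
  have hc : 0 ≤ liftC d * (6 / (M : ℝ) ^ 2 + 2 * ((d : ℝ) + 1) * 0) := by
    have := liftC_nonneg d; positivity
  refine h.trans ((mul_le_mul_of_nonneg_left hsum hc).trans (le_of_eq ?_))
  ring

/-! ## §3 (1.38) at the flat datum, summed by parts: `covDiv 1 Y + Δ_1λ ⊥ Δ_1N(Q′(1))` over the period box -/

/-- **THE EULER–LAGRANGE FORM OF (1.38) AT A UNITARY PERIODIC BACKGROUND**: if `Y + D_Wλ` is (1.38)-Landau (`IsLandauB8 L N k W`) with `Y`, `λ` periodic of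
period `N·L^k`, then for every `ν ∈ N(Q′(W))`, `Σ_{x ∈ periodBox (N·L^k)} hsR (covDiv_W Y x + Δ_W λ x) (Δ_W ν x) = 0` — summation by parts
(`NE3LandauOrbit.sum_hsR_gaugeDir`) and `covDiv_W ∘ D_W = Δ_W` (`LandauProjectionB8.covDiv_gaugeDir_eq_covLapSite`). [folklore] -/
theorem sum_hsR_covDiv_add_covLapSite_eq_zero_of_isLandauB8 {L N k : ℕ} (hP : 1 ≤ N * L ^ k)
    {W : Site d → Fin d → (Matrix n n ℂ)ˣ} (hWu : IsUnitaryCfg W) (hWP : IsPeriodicCfg W ((N * L ^ k : ℕ) : ℤ))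
    {Y : Site d → Fin d → Matrix n n ℂ} (hYP : IsPeriodicDir Y ((N * L ^ k : ℕ) : ℤ))
    {lam : Site d → Matrix n n ℂ} (hlamP : ∀ (y : Site d) (i : Fin d), lam (y + ((N * L ^ k : ℕ) : ℤ) • e i) = lam y)
    (hLan : IsLandauB8 (d := d) L N k W (fun y κ => Y y κ + gaugeDir W lam y κ))
    {nu : Site d → Matrix n n ℂ} (hnu : nu ∈ avgKernelGauges (d := d) (n := n) L N k W) :
    ∑ x ∈ periodBox (d := d) (N * L ^ k), hsR (covDiv W Y x + covLapSite W lam x) (covLapSite W nu x) = 0 := by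
  have hnuP : ∀ (y : Site d) (i : Fin d), nu (y + ((N * L ^ k : ℕ) : ℤ) • e i) = nu y := hnu.2.1
  have hZP : IsPeriodicDir (fun y κ => Y y κ + gaugeDir W lam y κ) ((N * L ^ k : ℕ) : ℤ) := by
    intro y i μ
    show Y (y + ((N * L ^ k : ℕ) : ℤ) • e i) μ + gaugeDir W lam (y + ((N * L ^ k : ℕ) : ℤ) • e i) μ = Y y μ + gaugeDir W lam y μ
    rw [hYP y i μ, isPeriodicDir_gaugeDir hWP hlamP y i μ]
  have hlapP : ∀ (y : Site d) (i : Fin d), covLapSite W nu (y + ((N * L ^ k : ℕ) : ℤ) • e i) = covLapSite W nu y :=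
    covLapSite_add_period hWP hnuP
  have h0 : ∑ x ∈ periodBox (d := d) (N * L ^ k), ∑ κ : Fin d,
      hsR ((fun y κ => Y y κ + gaugeDir W lam y κ) x κ) (gaugeDir W (covLapSite W nu) x κ) = 0 := hLan nu hnu
  rw [sum_hsR_gaugeDir hP hWu hZP hlapP] at h0
  have hdiv : ∀ x : Site d, covDiv W (fun y κ => Y y κ + gaugeDir W lam y κ) x = covDiv W Y x + covLapSite W lam x := by
    intro x
    rw [covDiv_add_fun, ← covDiv_gaugeDir_eq_covLapSite]
  simpa only [hdiv] using h0

/-! ## §4 The flat-datum `hK` from the two flat sup-norm facts -/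

section Main

variable [Nonempty n] {L : ℕ} (hL : 2 ≤ L) (j : ℕ) {x : ℝ} (hWu : IsUnitaryCfg (flatCfg (d := d) (n := n))) (hx : 0 ≤ x)
  (hs : LevelSmall d L j x) (hWx : SmallField (flatCfg (d := d) (n := n)) x) (N : ℕ) [NeZero N]
  (hθ : cruxC d L * (((L : ℝ) ^ (j + 1)) ^ 2 * x) < 1)

/-- **`hK` AT THE FLAT DATUM FROM TWO FLAT SUP-NORM FACTS** (every `d`, `L ≥ 2`, `j`, `N ≥ 1`; `M = L^{j+1}`).  Hypotheses, both about the flat site Laplacian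
`Δ_1 = covLapSite 1` and B8's test space `N(Q′(1)) = avgKernelGauges L N (j+1) 1` on the `(N·M)`-torus, with constants `c₀, c₁, c_R`:
* (H0) `hG` — SUP-REGULARITY OF `Δ_1` ON `N(Q′(1))` ([Balaban1984PropagatorsII] (2.67) entries `|G′λ|`, `|∇G′λ|` at `U = 1`, read on `Δ_1N(Q′(1))`, TYPE):
  for `u ∈ N(Q′(1))` with `‖Δ_1u‖_∞ ≤ B`: `‖u(y)‖ ≤ c₀·M²·B` and `‖D_1u(y, μ)‖ ≤ c₁·M·B`;
* (HR) `hR` — `ℓ^∞`-BOUNDEDNESS OF THE (1.38)-PROJECTION `R(1)` onto `Δ_1N(Q′(1))` ([Balaban1985BackgroundPropagators] (3.25)∕(3.49) for `P = I − R` at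
  `U = 1`, TYPE), in solution form: for skew `(N·M)`-periodic `F` and `μ ∈ N(Q′(1))` with `F + Δ_1μ ⊥_{hsR} Δ_1N(Q′(1))` over the period box and
  `‖F‖_∞ ≤ B`: `‖Δ_1μ(y)‖ ≤ c_R·B`.
Conclusion: `LandauCorrectionSupB8` at `W = flatCfg` with `K₀ = 6d·liftC·c₀·c_R`, `K₁ = 6d·liftC·c₁·c_R` (independent of `j`, `N`, `x`).  Proof: §1 (the lift of
the solved datum is the smooth lift of `φ`), §2 (`‖covDiv 1 Y‖_∞ ≤ 6d·liftC·s∕M²`), §3 (Euler–Lagrange form), then (HR) and (H0). [folklore] -/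
theorem landauCorrectionSupB8_flatCfg_of_supFacts {c₀ c₁ cR : ℝ}
    (hG : ∀ u ∈ avgKernelGauges (d := d) (n := n) L N (j + 1) (flatCfg (d := d) (n := n)), ∀ B : ℝ,
      (∀ y : Site d, ‖covLapSite (flatCfg (d := d) (n := n)) u y‖ ≤ B) →
        (∀ y : Site d, ‖u y‖ ≤ c₀ * ((L : ℝ) ^ (j + 1)) ^ 2 * B) ∧
        (∀ (y : Site d) (μ : Fin d), ‖gaugeDir (flatCfg (d := d) (n := n)) u y μ‖ ≤ c₁ * (L : ℝ) ^ (j + 1) * B))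
    (hR : ∀ (F : Site d → Matrix n n ℂ), (∀ y : Site d, F y ∈ skewAdjoint (Matrix n n ℂ)) →
      (∀ (y : Site d) (i : Fin d), F (y + ((N * L ^ (j + 1) : ℕ) : ℤ) • e i) = F y) →
      ∀ μ ∈ avgKernelGauges (d := d) (n := n) L N (j + 1) (flatCfg (d := d) (n := n)),
        (∀ ν ∈ avgKernelGauges (d := d) (n := n) L N (j + 1) (flatCfg (d := d) (n := n)),
          ∑ y ∈ periodBox (d := d) (N * L ^ (j + 1)),
            hsR (F y + covLapSite (flatCfg (d := d) (n := n)) μ y) (covLapSite (flatCfg (d := d) (n := n)) ν y) = 0) →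
        ∀ B : ℝ, (∀ y : Site d, ‖F y‖ ≤ B) → ∀ y : Site d, ‖covLapSite (flatCfg (d := d) (n := n)) μ y‖ ≤ cR * B) :
    LandauCorrectionSupB8 hL j hWu hx hs hWx N hθ (6 * (d : ℝ) * liftC d * c₀ * cR) (6 * (d : ℝ) * liftC d * c₁ * cR) := by
  intro φ hφ hφP s hs0 hφs lam hlam hLan
  have hL1 : 1 ≤ L := by omega
  have hN : 1 ≤ N := Nat.one_le_iff_ne_zero.mpr (NeZero.ne N)
  have hM2 : 2 ≤ L ^ (j + 1) := le_trans hL (Nat.le_self_pow (by omega) L)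
  have hP : 1 ≤ N * L ^ (j + 1) := Nat.mul_pos (by omega) (by omega)
  have hM0 : (0 : ℝ) < (L : ℝ) ^ (j + 1) := by positivity
  have hMr : ((L ^ (j + 1) : ℕ) : ℝ) = (L : ℝ) ^ (j + 1) := by push_cast; ring
  have hWP : IsPeriodicCfg (flatCfg (d := d) (n := n)) ((tower L N (j + 1) : ℕ) : ℤ) := isPeriodicCfg_flatCfg _
  have hWP' : IsPeriodicCfg (flatCfg (d := d) (n := n)) ((N * L ^ (j + 1) : ℕ) : ℤ) := isPeriodicCfg_flatCfg _
  -- the lift of the solved datum, its periodicity and skewness, and its flat identification with the smooth lift of `φ`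
  set Y : Site d → Fin d → Matrix n n ℂ := covLift (L ^ (j + 1)) (flatCfg (d := d) (n := n))
    (extDir N ((solveW hL j hWu hx hs hWx N hθ (resSkew N hφ) : ↥(skewSub d n N)) : TDir d n N)) with hYdef
  have hYP : IsPeriodicDir Y ((N * L ^ (j + 1) : ℕ) : ℤ) := covLift_solveW_periodic hL j (N := N) hWu hWP hx hs hWx hθ hφ
  have hYs : IsSkewDir Y := covLift_solveW_skew hL j (N := N) hWu hx hs hWx hθ hφ
  have hYφ : Y = covLift (L ^ (j + 1)) (flatCfg (d := d) (n := n)) φ := covLift_solveW_flatCfg hL j hWu hx hs hWx N hθ hφ hφP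
  -- the flat divergence source `F` and its sup
  set F : Site d → Matrix n n ℂ := covDiv (flatCfg (d := d) (n := n)) Y with hFdef
  set BF : ℝ := 6 * (d : ℝ) * liftC d / ((L : ℝ) ^ (j + 1)) ^ 2 * s with hBF
  have hFB : ∀ y : Site d, ‖F y‖ ≤ BF := by
    intro y
    rw [hFdef, hYφ, hBF, ← hMr]
    exact norm_covDiv_covLift_flatCfg_le hM2 φ hφs y
  have hFs : ∀ y : Site d, F y ∈ skewAdjoint (Matrix n n ℂ) := fun y => covDiv_mem_skewAdjoint hWu hYs y
  have hFP : ∀ (y : Site d) (i : Fin d), F (y + ((N * L ^ (j + 1) : ℕ) : ℤ) • e i) = F y := covDiv_add_period hWP' hYP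
  -- the Euler–Lagrange form of (1.38) and the (HR) bound on `Δ_1 λ`
  have hEL : ∀ ν ∈ avgKernelGauges (d := d) (n := n) L N (j + 1) (flatCfg (d := d) (n := n)),
      ∑ y ∈ periodBox (d := d) (N * L ^ (j + 1)),
        hsR (F y + covLapSite (flatCfg (d := d) (n := n)) lam y) (covLapSite (flatCfg (d := d) (n := n)) ν y) = 0 :=
    fun ν hν => sum_hsR_covDiv_add_covLapSite_eq_zero_of_isLandauB8 hP hWu hWP' hYP hlam.2.1 hLan hν
  have hΔ : ∀ y : Site d, ‖covLapSite (flatCfg (d := d) (n := n)) lam y‖ ≤ cR * BF := hR F hFs hFP lam hlam hEL BF hFB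
  -- (H0) on `λ ∈ N(Q′(1))`
  obtain ⟨h0, h1⟩ := hG lam hlam (cR * BF) hΔ
  refine ⟨fun y => (h0 y).trans (le_of_eq ?_), fun y μ => (h1 y μ).trans (le_of_eq ?_)⟩
  · rw [hBF]; field_simp
  · rw [hBF]; field_simp

end Main

/-! ## §5 The same reduction at a CURVED periodic background `W` (the END's per-pair `hK`): `hK(W)` ⇐ sup-regularity of `Δ_W` on `N(Q′(W))` ∧ `‖R(W)‖_∞` -/

section Curved

variable [Nonempty n] {L : ℕ} (hL : 2 ≤ L) (j : ℕ) {W : Site d → Fin d → (Matrix n n ℂ)ˣ} {x : ℝ} (hWu : IsUnitaryCfg W) (hx : 0 ≤ x)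
  (hs : LevelSmall d L j x) (hWx : SmallField W x) (N : ℕ) [NeZero N] (hθ : cruxC d L * (((L : ℝ) ^ (j + 1)) ^ 2 * x) < 1)

/-- **`hK` AT A UNITARY `(N·L^{j+1})`-PERIODIC BACKGROUND `W` OF THE LEVEL-`j` SMALL-FIELD CLASS FROM TWO SUP-NORM FACTS ABOUT `Δ_W`** (every `d`, `L ≥ 2`, `j`,
`N ≥ 1`; `M = L^{j+1}`, `θ = cruxC·M²·x < 1`) — the END's per-pair hypothesis `LandauCorrectionSupB8` pinned to its printed-TYPE content:
* (H0_W) `hG` — SUP-REGULARITY OF `Δ_W = covLapSite W` ON `N(Q′(W)) = avgKernelGauges L N (j+1) W` ([Balaban1985BackgroundPropagators] Thm 3.1∕3.3 (3.42), entries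
  `|G(U₀)λ|`, `|∇_{U₀}G(U₀)λ|`, read on `Δ_W N(Q′(W))`, TYPE): `u ∈ N(Q′(W))`, `‖Δ_Wu‖_∞ ≤ B` ⟹ `‖u(y)‖ ≤ c₀·M²·B`, `‖D_Wu(y, μ)‖ ≤ c₁·M·B`;
* (HR_W) `hR` — `ℓ^∞`-BOUNDEDNESS OF THE (1.38)-PROJECTION `R(W)` onto `Δ_WN(Q′(W))` ([Balaban1985BackgroundPropagators] (3.25)∕(3.49), `P = I − R`, TYPE), in
  solution form: skew `(N·M)`-periodic `F`, `μ ∈ N(Q′(W))`, `F + Δ_Wμ ⊥_{hsR} Δ_WN(Q′(W))` over the period box, `‖F‖_∞ ≤ B` ⟹ `‖Δ_Wμ(y)‖ ≤ c_R·B`.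
Then `LandauCorrectionSupB8 hL j hWu hx hs hWx N hθ K₀ K₁` with `K₀ = d·liftC·(6 + 2(d+1)·M²x)·c₀·c_R∕(1−θ)`, `K₁ = d·liftC·(6 + 2(d+1)·M²x)·c₁·c_R∕(1−θ)`
(k-free in the END's regime `M²x ≤ θ₀∕cruxC`, `θ ≤ θ₀ < 1`; `LandauCorrectionSupB8.mono` replaces them by uniform majorants).  Proof: the divergence letter
`CovLiftDivergenceB8.norm_covDiv_covLift_le` at plaquette radius `x` with the solve's sup `‖ψ‖_∞ ≤ s∕(1−θ)` (`NE3RightInverseSolveLetters.norm_solve_le`) gives the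
source bound `‖covDiv_W Y‖_∞ ≤ d·liftC·(6∕M² + 2(d+1)x)·s∕(1−θ)`; then §3, (HR_W), (H0_W).  NO `G∇*`, NO second-order (`∇G∇*`) and NO Hölder currency (3.43)∕(3.45)
enter: the smoothness of route Π's lift absorbs one derivative at every background of the class. [folklore] -/
theorem landauCorrectionSupB8_of_supFacts (hWP : IsPeriodicCfg W ((N * L ^ (j + 1) : ℕ) : ℤ)) {c₀ c₁ cR : ℝ}
    (hG : ∀ u ∈ avgKernelGauges (d := d) (n := n) L N (j + 1) W, ∀ B : ℝ, (∀ y : Site d, ‖covLapSite W u y‖ ≤ B) →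
        (∀ y : Site d, ‖u y‖ ≤ c₀ * ((L : ℝ) ^ (j + 1)) ^ 2 * B) ∧ (∀ (y : Site d) (μ : Fin d), ‖gaugeDir W u y μ‖ ≤ c₁ * (L : ℝ) ^ (j + 1) * B))
    (hR : ∀ (F : Site d → Matrix n n ℂ), (∀ y : Site d, F y ∈ skewAdjoint (Matrix n n ℂ)) →
      (∀ (y : Site d) (i : Fin d), F (y + ((N * L ^ (j + 1) : ℕ) : ℤ) • e i) = F y) →
      ∀ μ ∈ avgKernelGauges (d := d) (n := n) L N (j + 1) W,
        (∀ ν ∈ avgKernelGauges (d := d) (n := n) L N (j + 1) W,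
          ∑ y ∈ periodBox (d := d) (N * L ^ (j + 1)), hsR (F y + covLapSite W μ y) (covLapSite W ν y) = 0) →
        ∀ B : ℝ, (∀ y : Site d, ‖F y‖ ≤ B) → ∀ y : Site d, ‖covLapSite W μ y‖ ≤ cR * B) :
    LandauCorrectionSupB8 hL j hWu hx hs hWx N hθ
      ((d : ℝ) * liftC d * (6 + 2 * ((d : ℝ) + 1) * (((L : ℝ) ^ (j + 1)) ^ 2 * x)) * c₀ * cR / (1 - cruxC d L * (((L : ℝ) ^ (j + 1)) ^ 2 * x)))
      ((d : ℝ) * liftC d * (6 + 2 * ((d : ℝ) + 1) * (((L : ℝ) ^ (j + 1)) ^ 2 * x)) * c₁ * cR / (1 - cruxC d L * (((L : ℝ) ^ (j + 1)) ^ 2 * x))) := by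
  intro φ hφ hφP s hs0 hφs lam hlam hLan
  have hL1 : 1 ≤ L := by omega
  have hN : 1 ≤ N := Nat.one_le_iff_ne_zero.mpr (NeZero.ne N)
  have hM2 : 2 ≤ L ^ (j + 1) := le_trans hL (Nat.le_self_pow (by omega) L)
  have hP : 1 ≤ N * L ^ (j + 1) := Nat.mul_pos (by omega) (by omega)
  have hM0 : (0 : ℝ) < (L : ℝ) ^ (j + 1) := by positivity
  have hMr : ((L ^ (j + 1) : ℕ) : ℝ) = (L : ℝ) ^ (j + 1) := by push_cast; ring
  have hθpos : 0 < 1 - cruxC d L * (((L : ℝ) ^ (j + 1)) ^ 2 * x) := by linarith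
  have hWPt : IsPeriodicCfg W ((tower L N (j + 1) : ℕ) : ℤ) := by
    have hT : tower L N (j + 1) = N * L ^ (j + 1) := by rw [NE3SmoothLiftW.tower_eq_pow_mul, Nat.mul_comm]
    rw [hT]; exact hWP
  -- the lift of the solved datum: periodic, skew; the solved datum has sup `≤ s∕(1−θ)`
  set ψ : Site d → Fin d → Matrix n n ℂ :=
    extDir N ((solveW hL j hWu hx hs hWx N hθ (resSkew N hφ) : ↥(skewSub d n N)) : TDir d n N) with hψdef
  set Y : Site d → Fin d → Matrix n n ℂ := covLift (L ^ (j + 1)) W ψ with hYdef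
  have hYP : IsPeriodicDir Y ((N * L ^ (j + 1) : ℕ) : ℤ) := covLift_solveW_periodic hL j (N := N) hWu hWPt hx hs hWx hθ hφ
  have hYs : IsSkewDir Y := covLift_solveW_skew hL j (N := N) hWu hx hs hWx hθ hφ
  have hψs : ∀ (z : Site d) (κ : Fin d), ‖ψ z κ‖ ≤ s / (1 - cruxC d L * (((L : ℝ) ^ (j + 1)) ^ 2 * x)) :=
    fun z κ => NE3RightInverseSolveLetters.norm_solve_le hL j hWu hx hs hWx N hθ hφ hs0 hφs z κ
  have hs1 : 0 ≤ s / (1 - cruxC d L * (((L : ℝ) ^ (j + 1)) ^ 2 * x)) := div_nonneg hs0 hθpos.le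
  -- the divergence source `F` and its sup
  set F : Site d → Matrix n n ℂ := covDiv W Y with hFdef
  set BF : ℝ := (d : ℝ) * liftC d * (6 / ((L : ℝ) ^ (j + 1)) ^ 2 + 2 * ((d : ℝ) + 1) * x)
    * (s / (1 - cruxC d L * (((L : ℝ) ^ (j + 1)) ^ 2 * x))) with hBF
  have hFB : ∀ y : Site d, ‖F y‖ ≤ BF := by
    intro y
    have h := norm_covDiv_covLift_le hM2 hWu hx hWx ψ y
    rw [hMr] at h
    have hsum : ∑ μ : Fin d, ‖ψ (blk (L ^ (j + 1)) (y - e μ)) μ‖ ≤ (d : ℝ) * (s / (1 - cruxC d L * (((L : ℝ) ^ (j + 1)) ^ 2 * x))) := by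
      calc ∑ μ : Fin d, ‖ψ (blk (L ^ (j + 1)) (y - e μ)) μ‖
          ≤ ∑ _μ : Fin d, s / (1 - cruxC d L * (((L : ℝ) ^ (j + 1)) ^ 2 * x)) := Finset.sum_le_sum fun μ _ => hψs _ μ
        _ = (d : ℝ) * (s / (1 - cruxC d L * (((L : ℝ) ^ (j + 1)) ^ 2 * x))) := by simp
    have hc : 0 ≤ liftC d * (6 / ((L : ℝ) ^ (j + 1)) ^ 2 + 2 * ((d : ℝ) + 1) * x) := by
      have := liftC_nonneg d; positivity
    refine h.trans ((mul_le_mul_of_nonneg_left hsum hc).trans (le_of_eq ?_))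
    rw [hBF]; ring
  have hFs : ∀ y : Site d, F y ∈ skewAdjoint (Matrix n n ℂ) := fun y => covDiv_mem_skewAdjoint hWu hYs y
  have hFP : ∀ (y : Site d) (i : Fin d), F (y + ((N * L ^ (j + 1) : ℕ) : ℤ) • e i) = F y := covDiv_add_period hWP hYP
  -- the Euler–Lagrange form of (1.38) and the (HR_W) bound on `Δ_W λ`
  have hEL : ∀ ν ∈ avgKernelGauges (d := d) (n := n) L N (j + 1) W,
      ∑ y ∈ periodBox (d := d) (N * L ^ (j + 1)), hsR (F y + covLapSite W lam y) (covLapSite W ν y) = 0 :=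
    fun ν hν => sum_hsR_covDiv_add_covLapSite_eq_zero_of_isLandauB8 hP hWu hWP hYP hlam.2.1 hLan hν
  have hΔ : ∀ y : Site d, ‖covLapSite W lam y‖ ≤ cR * BF := hR F hFs hFP lam hlam hEL BF hFB
  -- (H0_W) on `λ ∈ N(Q′(W))`
  obtain ⟨h0, h1⟩ := hG lam hlam (cR * BF) hΔ
  refine ⟨fun y => (h0 y).trans (le_of_eq ?_), fun y μ => (h1 y μ).trans (le_of_eq ?_)⟩
  · rw [hBF]; field_simp
  · rw [hBF]; field_simp

end Curved

end

end Summit.QuantumFields.BalabanUV.T4Continuum.NE3.LandauCorrectionSupB8Flat
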